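import Literature.Probability.RandomPlanarGeometry.SAWCountZdBadWordTypes
import HarnessLib

/-!
# Reversal-free step words with a planted letter pattern: word counts, and type counts read off falling-factorial expansions

Topic `Literature/Probability/RandomPlanarGeometry` (tools for the census laws of the `1/d` expansion of `c_n(ℤ^d)`; continues
`SAWCountZdBadWordTypes.lean` (a-p1 g20: the bad memory-2 walks as CANONICAL step words) on a-p3 g18's type calculus
`SAWPulledLargeForceExpansionZdWordTypes.lean` (`Word`, `SameType`, `canon`, `numAxes`, ★ `card_filter_sameType`, ★ the master formula
`card_filter_eq_sum_transversal`); `Percolation.DualContours`: step words, `stepVec`, `wordPos`).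

PRINTED CONTEXT (locators only; nothing is quoted digit-for-digit). Madras–Slade (1993) §1.2 p. 10 ("memory `τ = 2` simply rules out immediate
reversals", `c_{N,2} = 2d(2d−1)^{N−1}`), Definition 1.2.4, §1.1 eq. (1.1.8) p. 5 (the `1/d` expansion). NOT IN PRINT (lane statements): all of the
below — the counting device of the lane's census law (L1) (the fourth coefficient of `c_n(ℤ^d)`).

THE DEVICE. A condition `Q` on step words that depends only on the axis type has `#{w ∈ Word n D : Q w} = Σ_j N_j · D(D−1)⋯(D−j+1)` for every
`D`, with `N_j` the number of CANONICAL words satisfying `Q` with exactly `j` axes (the master formula run over ALL types, `card_filter_eq_sum_canonWords`);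
so when the left side is an explicit polynomial in `D`, the top type counts `N_j` are READ OFF its falling-factorial expansion
(`eq_coeff_of_sum_descFactorial`: `N_m = [X^m]P`, `N_{m−1} = [X^{m−1}]P + C(m,2)·N_m`). For a reversal-free word with a LETTER PATTERN planted at a
window (each letter of the window a prescribed copy or reverse of one of `f` free letters with distinct axes) the left side IS explicit:
`(2D−1)^{n−m} · 2^f · D(D−1)⋯(D−f+1)` (`card_noRev_atWindow_isPat`: every letter outside the window is a free non-reversing choice).

THIS FILE (lane «pcv-sawmu», a-p1 g21; all PROVED, standard axioms; tool notions `NoRev`, `window`, `AtWindow`, `canonWords`, `Pat`, `Pat.free`,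
`Pat.Good`, `IsPat`, `patWord` — not notions in print):
* reversal-free words: `noRev_snoc_iff`, `noRev_cons_iff`, ★ `card_noRev_snoc` / `card_noRev_cons` (one more letter: `× (2D−1)`), `card_noRev`
  (`2D(2D−1)^{L−1}`); windows: `atWindow_iff_init`, `atWindow_succ_iff_tail`, ★ `card_noRev_atWindow` (THE PLANTED-WINDOW COUNT
  `#{reversal-free, P at window k} = (2D−1)^{n−m} · #{reversal-free P-words of length m}`);
* types: `count_canonWords` (`Σ_{τ canonical} D^{(numAxes τ)} = (2D)^L`), ★ `card_filter_eq_sum_canonWords` / `card_filter_eq_sum_numAxes` (master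
  formula over all types), `descPochhammer_coeff_pred` (`[X^u]X^{(u+1)} = −C(u+1,2)`), ★ `eq_coeff_of_sum_descFactorial`, ★★ `card_canonical_numAxes_eq_coeff`
  (THE TWO TOP TYPE COUNTS of a type-invariant family counted by a polynomial);
* non-first positions: `numAxes_add_card_not_isFirst` (`numAxes + #non-first = n`), `numAxes_add_card_le`;
* letter patterns: `IsPat.noRev` (a good pattern on distinct axes is reversal-free), `isPat_iff_of_sameType` (type invariance), ★ `card_isPat`
  (`2^f · D^{(f)}`), `numAxes_le_of_atWindow_isPat` (the `m − f` forced non-first positions), ★ `card_noRev_atWindow_isPat`, `eval_patPoly` /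
  `coeff_patPoly` (the interpolating polynomial `2^{f+e} X^{(f)} (X − ½)^e` and its top two coefficients), ★★ `card_canonical_atWindow_isPat` —
  for a good pattern with `f` free letters planted in canonical reversal-free words of length `n`: exactly `2^{f+n−m}` of them have the maximal
  number `f + n − m` of axes and `2^{f+n−m}(C(f+n−m, 2) − C(f,2) − (n−m)/2)` have one axis fewer.
[cite: MadrasSlade1993, §1.2 (p. 10); Definition 1.2.4; §1.1 eq. (1.1.8) p. 5]

Provenance: lane «pcv-sawmu», a-p1 g21 (2026-08-27).
-/

noncomputable section

open Finset
open scoped BigOperators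
open Literature.Probability.LatticeModels
open Literature.Probability.RandomPlanarGeometry.SAW
open Literature.Probability.Percolation

namespace Literature.Probability.RandomPlanarGeometry.SAW.Zd

namespace WordTypes

variable {L D : ℕ}

/-! ### Reversal-free words and one-letter extensions -/

/-- No immediate reversal: consecutive letters are never `(x, s), (x, ¬s)` (the word form of memory 2, `isMemory_two_wordPos_iff`).
[cite: MadrasSlade1993, §1.2 (p. 10); lane tool notion] -/
abbrev NoRev (w : Word L D) : Prop := ∀ p : Fin L, ∀ hp : p.val + 1 < L, w ⟨p.val + 1, hp⟩ ≠ ((w p).1, !(w p).2)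

/-- `NoRev` unfolds to the inline form used across the lane's files. [cite: MadrasSlade1993, §1.2 (p. 10); lane plumbing] -/
theorem noRev_iff (w : Word L D) : NoRev w ↔ ∀ p : Fin L, ∀ hp : p.val + 1 < L, w ⟨p.val + 1, hp⟩ ≠ ((w p).1, !(w p).2) :=
  Iff.rfl

/-- Appending a letter: `Fin.snoc u a` at an old position. [cite: MadrasSlade1993, §1.2 (p. 10); lane plumbing] -/
theorem snoc_apply_lt (u : Word L D) (a : Idx D) {i : ℕ} (hi : i < L) :
    (Fin.snoc u a : Word (L + 1) D) ⟨i, by omega⟩ = u ⟨i, hi⟩ := by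
  have : (⟨i, by omega⟩ : Fin (L + 1)) = Fin.castSucc ⟨i, hi⟩ := rfl
  rw [this, Fin.snoc_castSucc]

/-- Appending a letter: `Fin.snoc u a` at the new position. [cite: MadrasSlade1993, §1.2 (p. 10); lane plumbing] -/
theorem snoc_apply_last (u : Word L D) (a : Idx D) : (Fin.snoc u a : Word (L + 1) D) ⟨L, by omega⟩ = a := by
  have : (⟨L, by omega⟩ : Fin (L + 1)) = Fin.last L := rfl
  rw [this, Fin.snoc_last]

/-- Prepending a letter: `Fin.cons a u` at position `0`. [cite: MadrasSlade1993, §1.2 (p. 10); lane plumbing] -/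
theorem cons_apply_zero (a : Idx D) (u : Word L D) : (Fin.cons a u : Word (L + 1) D) ⟨0, by omega⟩ = a := rfl

/-- Prepending a letter: `Fin.cons a u` at position `i + 1`. [cite: MadrasSlade1993, §1.2 (p. 10); lane plumbing] -/
theorem cons_apply_succ (a : Idx D) (u : Word L D) {i : ℕ} (hi : i < L) :
    (Fin.cons a u : Word (L + 1) D) ⟨i + 1, by omega⟩ = u ⟨i, hi⟩ := by
  have : (⟨i + 1, by omega⟩ : Fin (L + 1)) = Fin.succ ⟨i, hi⟩ := rfl
  rw [this, Fin.cons_succ]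

/-- `NoRev` with natural-number indices. [cite: MadrasSlade1993, §1.2 (p. 10); lane plumbing] -/
theorem noRev_iff_nat (w : Word L D) :
    NoRev w ↔ ∀ i : ℕ, ∀ hi : i + 1 < L, w ⟨i + 1, hi⟩ ≠ ((w ⟨i, by omega⟩).1, !(w ⟨i, by omega⟩).2) := by
  constructor
  · intro h i hi
    exact h ⟨i, by omega⟩ hi
  · rintro h ⟨i, hi⟩ hp
    exact h i hp

/-- Reversal-freeness of `Fin.snoc u a` (`L ≥ 1`): `u` is reversal-free and `a` is not the reverse of the last letter of `u`.
[cite: MadrasSlade1993, §1.2 (p. 10); lane lemma] -/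
theorem noRev_snoc_iff {L : ℕ} (u : Word (L + 1) D) (a : Idx D) :
    NoRev (Fin.snoc u a : Word (L + 2) D) ↔ NoRev u ∧ a ≠ ((u ⟨L, by omega⟩).1, !(u ⟨L, by omega⟩).2) := by
  rw [noRev_iff_nat, noRev_iff_nat]
  constructor
  · intro h
    refine ⟨fun i hi => ?_, ?_⟩
    · have := h i (by omega)
      rwa [snoc_apply_lt u a hi, snoc_apply_lt u a (show i < L + 1 by omega)] at this
    · have := h L (by omega)
      rwa [snoc_apply_last, snoc_apply_lt u a (show L < L + 1 by omega)] at this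
  · rintro ⟨hu, ha⟩ i hi
    by_cases hiL : i + 1 < L + 1
    · rw [snoc_apply_lt u a hiL, snoc_apply_lt u a (show i < L + 1 by omega)]
      exact hu i hiL
    · have hi' : i = L := by omega
      subst hi'
      rw [snoc_apply_last, snoc_apply_lt u a (show i < i + 1 by omega)]
      exact ha

/-- Reversal-freeness of `Fin.cons a u` (`L ≥ 1`): `u` is reversal-free and the first letter of `u` is not the reverse of `a`.
[cite: MadrasSlade1993, §1.2 (p. 10); lane lemma] -/
theorem noRev_cons_iff {L : ℕ} (a : Idx D) (u : Word (L + 1) D) :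
    NoRev (Fin.cons a u : Word (L + 2) D) ↔ NoRev u ∧ u ⟨0, by omega⟩ ≠ (a.1, !a.2) := by
  rw [noRev_iff_nat, noRev_iff_nat]
  constructor
  · intro h
    refine ⟨fun i hi => ?_, ?_⟩
    · have := h (i + 1) (by omega)
      rwa [cons_apply_succ a u hi, cons_apply_succ a u (show i < L + 1 by omega)] at this
    · have := h 0 (by omega)
      rwa [cons_apply_succ a u (show 0 < L + 1 by omega)] at this
  · rintro ⟨hu, ha⟩ i hi
    by_cases hi0 : i = 0
    · subst hi0
      rw [cons_apply_succ a u (show 0 < L + 1 by omega)]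
      exact ha
    · obtain ⟨j, rfl⟩ : ∃ j, i = j + 1 := ⟨i - 1, by omega⟩
      rw [cons_apply_succ a u (show j + 1 < L + 1 by omega), cons_apply_succ a u (show j < L + 1 by omega)]
      exact hu j (by omega)

/-- The letters other than a given one number `2D − 1`. [cite: MadrasSlade1993, §1.2 (p. 10); lane plumbing] -/
theorem card_filter_ne_letter (c : Idx D) : (Finset.univ.filter fun a : Idx D => a ≠ c).card = 2 * D - 1 := by
  rw [Finset.filter_ne' Finset.univ c, Finset.card_erase_of_mem (Finset.mem_univ c), Finset.card_univ, Fintype.card_prod,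
    Fintype.card_fin, Fintype.card_bool, mul_comm]

/-- ★ BACK EXTENSION: appending a letter to a reversal-free word of positive length, under a condition on the old part, multiplies
the count by `2D − 1`. [cite: MadrasSlade1993, §1.2 (p. 10: `c_{N,2} = 2d(2d−1)^{N−1}`); lane lemma] -/
theorem card_noRev_snoc {L : ℕ} (hL : 0 < L) (Q : Word L D → Prop) [DecidablePred Q] :
    (Finset.univ.filter fun w : Word (L + 1) D => NoRev w ∧ Q (Fin.init w)).card =
      (2 * D - 1) * (Finset.univ.filter fun u : Word L D => NoRev u ∧ Q u).card := by
  classical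
  obtain ⟨L, rfl⟩ : ∃ L', L = L' + 1 := ⟨L - 1, by omega⟩
  set S := Finset.univ.filter fun w : Word (L + 2) D => NoRev w ∧ Q (Fin.init w) with hS
  set T := Finset.univ.filter fun u : Word (L + 1) D => NoRev u ∧ Q u with hT
  have hmaps : ∀ w ∈ S, Fin.init w ∈ T := by
    intro w hw
    obtain ⟨hrev, hq⟩ := (Finset.mem_filter.1 hw).2
    refine Finset.mem_filter.2 ⟨Finset.mem_univ _, ?_, hq⟩
    have h := (noRev_snoc_iff (Fin.init w) (w (Fin.last (L + 1)))).1 (by rw [Fin.snoc_init_self]; exact hrev)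
    exact h.1
  rw [Finset.card_eq_sum_card_fiberwise hmaps]
  have hfib : ∀ u ∈ T, (S.filter fun w => Fin.init w = u).card = 2 * D - 1 := by
    intro u hu
    obtain ⟨hrev, hq⟩ := (Finset.mem_filter.1 hu).2
    have himg : (S.filter fun w => Fin.init w = u) =
        (Finset.univ.filter fun a : Idx D => a ≠ ((u ⟨L, by omega⟩).1, !(u ⟨L, by omega⟩).2)).image
          fun a => (Fin.snoc u a : Word (L + 2) D) := by
      ext w
      simp only [hS, Finset.mem_filter, Finset.mem_univ, true_and, Finset.mem_image]
      constructor
      · rintro ⟨⟨hw, -⟩, hwu⟩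
        refine ⟨w (Fin.last (L + 1)), ?_, by rw [← hwu, Fin.snoc_init_self]⟩
        have h := (noRev_snoc_iff (Fin.init w) (w (Fin.last (L + 1)))).1 (by rw [Fin.snoc_init_self]; exact hw)
        rw [hwu] at h
        exact h.2
      · rintro ⟨a, ha, rfl⟩
        rw [Fin.init_snoc]
        exact ⟨⟨(noRev_snoc_iff u a).2 ⟨hrev, ha⟩, hq⟩, rfl⟩
    rw [himg, Finset.card_image_of_injective _ (fun a b hab => by simpa using congrFun hab (Fin.last (L + 1))),
      card_filter_ne_letter]
  rw [Finset.sum_congr rfl hfib, Finset.sum_const, smul_eq_mul, mul_comm]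

/-- ★ FRONT EXTENSION: prepending a letter to a reversal-free word of positive length, under a condition on the old part, multiplies
the count by `2D − 1`. [cite: MadrasSlade1993, §1.2 (p. 10); lane lemma] -/
theorem card_noRev_cons {L : ℕ} (hL : 0 < L) (Q : Word L D → Prop) [DecidablePred Q] :
    (Finset.univ.filter fun w : Word (L + 1) D => NoRev w ∧ Q (Fin.tail w)).card =
      (2 * D - 1) * (Finset.univ.filter fun u : Word L D => NoRev u ∧ Q u).card := by
  classical
  obtain ⟨L, rfl⟩ : ∃ L', L = L' + 1 := ⟨L - 1, by omega⟩
  set S := Finset.univ.filter fun w : Word (L + 2) D => NoRev w ∧ Q (Fin.tail w) with hS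
  set T := Finset.univ.filter fun u : Word (L + 1) D => NoRev u ∧ Q u with hT
  have hmaps : ∀ w ∈ S, Fin.tail w ∈ T := by
    intro w hw
    obtain ⟨hrev, hq⟩ := (Finset.mem_filter.1 hw).2
    refine Finset.mem_filter.2 ⟨Finset.mem_univ _, ?_, hq⟩
    have h := (noRev_cons_iff (w 0) (Fin.tail w)).1 (by rw [Fin.cons_self_tail]; exact hrev)
    exact h.1
  rw [Finset.card_eq_sum_card_fiberwise hmaps]
  have hfib : ∀ u ∈ T, (S.filter fun w => Fin.tail w = u).card = 2 * D - 1 := by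
    intro u hu
    obtain ⟨hrev, hq⟩ := (Finset.mem_filter.1 hu).2
    -- the admissible first letters: `a` with `u 0 ≠ rev a`, i.e. `a ≠ rev (u 0)`
    have himg : (S.filter fun w => Fin.tail w = u) =
        (Finset.univ.filter fun a : Idx D => a ≠ ((u ⟨0, by omega⟩).1, !(u ⟨0, by omega⟩).2)).image
          fun a => (Fin.cons a u : Word (L + 2) D) := by
      ext w
      simp only [hS, Finset.mem_filter, Finset.mem_univ, true_and, Finset.mem_image]
      constructor
      · rintro ⟨⟨hw, -⟩, hwu⟩
        refine ⟨w 0, ?_, by rw [← hwu, Fin.cons_self_tail]⟩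
        have h := (noRev_cons_iff (w 0) (Fin.tail w)).1 (by rw [Fin.cons_self_tail]; exact hw)
        rw [hwu] at h
        intro ha
        apply h.2
        rw [ha]
        simp
      · rintro ⟨a, ha, rfl⟩
        rw [Fin.tail_cons]
        refine ⟨⟨(noRev_cons_iff a u).2 ⟨hrev, fun h => ha ?_⟩, hq⟩, rfl⟩
        rw [Prod.ext_iff] at h
        obtain ⟨h1, h2⟩ := h
        refine Prod.ext h1.symm ?_
        simp only at h2 ⊢
        rw [h2, Bool.not_not]
    rw [himg, Finset.card_image_of_injective _ (fun a b hab => by simpa using congrFun hab 0), card_filter_ne_letter]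
  rw [Finset.sum_congr rfl hfib, Finset.sum_const, smul_eq_mul, mul_comm]

/-- All reversal-free words: `2D(2D−1)^{L−1}` of length `L ≥ 1` (the word form of `memCount_two`).
[cite: MadrasSlade1993, §1.2 (p. 10: `c_{N,2} = 2d(2d−1)^{N−1}`); lane lemma] -/
theorem card_noRev (L : ℕ) (hL : 0 < L) :
    (Finset.univ.filter fun w : Word L D => NoRev w).card = 2 * D * (2 * D - 1) ^ (L - 1) := by
  classical
  obtain ⟨L, rfl⟩ : ∃ L', L = L' + 1 := ⟨L - 1, by omega⟩
  induction L with
  | zero =>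
    have hall : (Finset.univ.filter fun w : Word 1 D => NoRev w) = Finset.univ :=
      Finset.filter_true_of_mem fun w _ p hp => absurd hp (by omega)
    rw [hall, Finset.card_univ, card_word, pow_one]
    simp
  | succ L ih =>
    have h := card_noRev_snoc (D := D) (L := L + 1) (by omega) (fun _ => True)
    simp only [and_true] at h
    rw [h, ih (by omega), show L + 1 + 1 - 1 = (L + 1 - 1) + 1 by omega, pow_succ]
    ring

/-! ### Windows -/

variable {n m : ℕ}

/-- The window of length `m` at offset `k` of a word of length `n` (`k + m ≤ n`). [cite: MadrasSlade1993, §1.2 (p. 10); lane tool notion] -/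
def window (m k : ℕ) (w : Word n D) (h : k + m ≤ n) : Word m D := fun i => w ⟨k + i.val, by omega⟩

/-- `AtWindow P k w`: the word `w` is long enough and its window of length `m` at offset `k` satisfies `P`.
[cite: MadrasSlade1993, §1.2 (p. 10); lane tool notion] -/
abbrev AtWindow (P : Word m D → Prop) (k : ℕ) (w : Word n D) : Prop := ∃ h : k + m ≤ n, P (window m k w h)

/-- The letters of a window. [cite: MadrasSlade1993, §1.2 (p. 10); lane plumbing] -/
theorem window_apply (m k : ℕ) (w : Word n D) (h : k + m ≤ n) (i : Fin m) : window m k w h i = w ⟨k + i.val, by omega⟩ := rfl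

/-- A window away from the last letter is a window of `Fin.init`. [cite: MadrasSlade1993, §1.2 (p. 10); lane plumbing] -/
theorem atWindow_iff_init (P : Word m D → Prop) {k : ℕ} (w : Word (n + 1) D) (h : k + m ≤ n) :
    AtWindow P k w ↔ AtWindow P k (Fin.init w) := by
  unfold AtWindow
  have key : ∀ (h₁ : k + m ≤ n + 1) (h₂ : k + m ≤ n), window m k w h₁ = window m k (Fin.init w) h₂ := fun _ _ => rfl
  constructor
  · rintro ⟨h', hP⟩
    exact ⟨h, by rwa [← key h' h]⟩
  · rintro ⟨h', hP⟩
    exact ⟨by omega, by rwa [key (by omega) h']⟩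

/-- A window at offset `k + 1` is a window of `Fin.tail` at offset `k`. [cite: MadrasSlade1993, §1.2 (p. 10); lane plumbing] -/
theorem atWindow_succ_iff_tail (P : Word m D → Prop) (k : ℕ) (w : Word (n + 1) D) :
    AtWindow P (k + 1) w ↔ AtWindow P k (Fin.tail w) := by
  unfold AtWindow
  have key : ∀ (h : k + 1 + m ≤ n + 1) (h' : k + m ≤ n), window m (k + 1) w h = window m k (Fin.tail w) h' := by
    intro h h'
    funext i
    simp only [window_apply, Fin.tail]
    exact congrArg w (Fin.ext (by simp only [Fin.succ_mk]; omega))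
  constructor
  · rintro ⟨h, hP⟩
    exact ⟨by omega, by rwa [← key h (by omega)]⟩
  · rintro ⟨h', hP⟩
    exact ⟨by omega, by rwa [key (by omega) h']⟩

/-- The window at offset `0` of a word of the window's length is the word. [cite: MadrasSlade1993, §1.2 (p. 10); lane plumbing] -/
theorem atWindow_zero_iff (P : Word m D → Prop) (w : Word m D) : AtWindow P 0 w ↔ P w := by
  unfold AtWindow
  have key : ∀ h : 0 + m ≤ m, window m 0 w h = w := fun h => funext fun i => congrArg w (Fin.ext (by simp))
  constructor
  · rintro ⟨h, hP⟩; rwa [key h] at hP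
  · intro hP; exact ⟨by omega, by rwa [key]⟩

/-- ★ THE PLANTED-WINDOW COUNT: among the words of length `m + k + j` over `D` axes, the reversal-free ones whose window of length
`m ≥ 1` at offset `k` satisfies `P` number `(2D−1)^{k+j}` times the reversal-free words of length `m` satisfying `P` — each of the
`k` letters before and the `j` letters after the window is a free non-reversing choice. [cite: MadrasSlade1993, §1.2 (p. 10); lane theorem] -/
theorem card_noRev_atWindow_add (hm : 0 < m) (P : Word m D → Prop) [DecidablePred P] (k j : ℕ) :
    (Finset.univ.filter fun w : Word (m + k + j) D => NoRev w ∧ AtWindow P k w).card =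
      (2 * D - 1) ^ (k + j) * (Finset.univ.filter fun h : Word m D => NoRev h ∧ P h).card := by
  classical
  induction j with
  | zero =>
    induction k with
    | zero =>
      rw [pow_zero, one_mul]
      exact congrArg Finset.card (Finset.filter_congr fun w _ => and_congr Iff.rfl (atWindow_zero_iff P w))
    | succ k ih =>
      have h := card_noRev_cons (D := D) (L := m + k) (by omega) (fun u => AtWindow P k u)
      rw [show m + (k + 1) + 0 = m + k + 1 by omega]
      rw [show m + k + 0 = m + k by omega] at ih
      rw [Finset.filter_congr fun w _ => by rw [atWindow_succ_iff_tail], h, ih, ← mul_assoc, ← pow_succ',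
        show k + 1 + 0 = (k + 0) + 1 by omega]
  | succ j ih =>
    have h := card_noRev_snoc (D := D) (L := m + k + j) (by omega) (fun u => AtWindow P k u)
    rw [show m + k + (j + 1) = m + k + j + 1 by omega,
      Finset.filter_congr fun w _ => by rw [atWindow_iff_init P w (show k + m ≤ m + k + j by omega)], h, ih, ← mul_assoc,
      ← pow_succ', show k + (j + 1) = (k + j) + 1 by omega]

/-- ★ The planted-window count for a word of any length `n ≥ k + m`. [cite: MadrasSlade1993, §1.2 (p. 10); lane theorem] -/
theorem card_noRev_atWindow (hm : 0 < m) (P : Word m D → Prop) [DecidablePred P] {k n : ℕ} (hn : k + m ≤ n) :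
    (Finset.univ.filter fun w : Word n D => NoRev w ∧ AtWindow P k w).card =
      (2 * D - 1) ^ (n - m) * (Finset.univ.filter fun h : Word m D => NoRev h ∧ P h).card := by
  obtain ⟨j, rfl⟩ : ∃ j, n = m + k + j := ⟨n - m - k, by omega⟩
  rw [card_noRev_atWindow_add hm, show m + k + j - m = k + j by omega]

/-! ### Type counts: the master formula over ALL canonical words, and reading counts off a falling-factorial expansion -/

/-- The canonical words of length `L` (`canon τ = τ`): one per axis type. [cite: MadrasSlade1993, Definition 1.2.4; lane tool notion] -/
def canonWords (L : ℕ) : Finset (Word L L) := Finset.univ.filter fun τ => canon τ = τ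

/-- Membership in `canonWords`. [cite: MadrasSlade1993, Definition 1.2.4; lane plumbing] -/
theorem mem_canonWords {τ : Word L L} : τ ∈ canonWords L ↔ canon τ = τ := by
  simp [canonWords]

/-- `canon u` is canonical. [cite: MadrasSlade1993, Definition 1.2.4; lane plumbing] -/
theorem canon_canon (u : Word L D) : canon (canon u) = canon u := (sameType_canon u).canon_eq.symm

/-- ★ The type classes of the canonical words exhaust `Word L D`: `Σ_{τ canonical} D^{(numAxes τ)} = (2D)^L` for every `L`, `D`
(the total-size hypothesis of a-p3's master formula, for the full transversal). [cite: MadrasSlade1993, Definition 1.2.4; lane lemma] -/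
theorem count_canonWords (L D : ℕ) : ∑ τ ∈ canonWords L, D.descFactorial (numAxes τ) = (2 * D) ^ L := by
  classical
  set C : Word L L → Finset (Word L D) := fun τ => Finset.univ.filter fun u => SameType u τ with hC
  have hdisj : (canonWords L : Set (Word L L)).PairwiseDisjoint C := by
    intro τ hτ τ' hτ' hne
    refine Finset.disjoint_left.2 fun u hu hu' => hne ?_
    have h1 : SameType u τ := (Finset.mem_filter.1 hu).2
    have h2 : SameType u τ' := (Finset.mem_filter.1 hu').2
    rw [← mem_canonWords.1 hτ, ← mem_canonWords.1 hτ']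
    exact (h1.symm.trans h2).canon_eq
  have hunion : (canonWords L).biUnion C = Finset.univ := by
    refine Finset.eq_univ_of_forall fun u => Finset.mem_biUnion.2 ⟨canon u, mem_canonWords.2 (canon_canon u), ?_⟩
    exact Finset.mem_filter.2 ⟨Finset.mem_univ _, sameType_canon u⟩
  have := congrArg Finset.card hunion
  rw [Finset.card_biUnion hdisj, Finset.card_univ, card_word] at this
  rw [← this]
  exact Finset.sum_congr rfl fun τ _ => (card_filter_sameType τ D).symm

/-- ★ MASTER FORMULA OVER ALL TYPES: a type-invariant count over `Word L D` is `Σ_{τ canonical} [Q₀ τ]·D^{(numAxes τ)}`.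
[cite: MadrasSlade1993, Definition 1.2.4; lane lemma] -/
theorem card_filter_eq_sum_canonWords (Q : Word L D → Prop) [DecidablePred Q] (Q₀ : Word L L → Prop) [DecidablePred Q₀]
    (hQ : ∀ u : Word L D, Q u ↔ Q₀ (canon u)) :
    (Finset.univ.filter Q).card = ∑ τ ∈ canonWords L, if Q₀ τ then D.descFactorial (numAxes τ) else 0 :=
  card_filter_eq_sum_transversal (canonWords L) (fun _ hτ => mem_canonWords.1 hτ) (count_canonWords L D) Q Q₀ hQ

/-- The same, grouped by the number of axes: `#{u ∈ Word L D : Q u} = Σ_{j ≤ L} N_j · D^{(j)}` with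
`N_j = #{τ canonical : Q₀ τ, numAxes τ = j}`. [cite: MadrasSlade1993, Definition 1.2.4; lane lemma] -/
theorem card_filter_eq_sum_numAxes (Q : Word L D → Prop) [DecidablePred Q] (Q₀ : Word L L → Prop) [DecidablePred Q₀]
    (hQ : ∀ u : Word L D, Q u ↔ Q₀ (canon u)) :
    (Finset.univ.filter Q).card =
      ∑ j ∈ Finset.range (L + 1), ((canonWords L).filter fun τ => Q₀ τ ∧ numAxes τ = j).card * D.descFactorial j := by
  rw [card_filter_eq_sum_canonWords Q Q₀ hQ, sum_ite_descFactorial_numAxes]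
  refine Finset.sum_congr rfl fun j _ => ?_
  rw [Finset.filter_filter]

/-- A rational polynomial is determined by its values on `ℕ`. [cite: MadrasSlade1993, §1.1 eq. (1.1.8) p. 5; lane plumbing] -/
theorem poly_eq_of_eval_natCast_eq {P Q : Polynomial ℚ} (h : ∀ d : ℕ, P.eval (d : ℚ) = Q.eval (d : ℚ)) : P = Q := by
  apply Polynomial.eq_of_infinite_eval_eq
  refine Set.Infinite.mono ?_ (Set.infinite_range_of_injective Nat.cast_injective)
  rintro x ⟨d, rfl⟩
  exact h d

/-- `descPochhammer ℚ u` is monic of degree `u`. [cite: MadrasSlade1993, §1.1 eq. (1.1.8) p. 5; lane plumbing] -/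
theorem descPochhammer_coeff_self (u : ℕ) : (descPochhammer ℚ u).coeff u = 1 := by
  have h := monic_descPochhammer ℚ u
  rw [Polynomial.Monic, Polynomial.leadingCoeff, descPochhammer_natDegree] at h
  exact h

/-- The second coefficient of the falling factorial: `[X^u] X(X−1)⋯(X−u) = −C(u+1, 2)`.
[cite: MadrasSlade1993, §1.1 eq. (1.1.8) p. 5; lane plumbing] -/
theorem descPochhammer_coeff_pred (u : ℕ) : (descPochhammer ℚ (u + 1)).coeff u = -(((u + 1).choose 2 : ℕ) : ℚ) := by
  induction u with
  | zero => simp [descPochhammer_one]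
  | succ u ih =>
    rw [descPochhammer_succ_right, mul_sub, Polynomial.coeff_sub, Polynomial.coeff_mul_X, ih,
      show ((u + 1 : ℕ) : Polynomial ℚ) = Polynomial.C ((u + 1 : ℕ) : ℚ) by rw [Polynomial.C_eq_natCast],
      Polynomial.coeff_mul_C, descPochhammer_coeff_self, Nat.choose_succ_succ' (u + 1) 1, Nat.choose_one_right]
    push_cast
    ring

/-- `[X^k] descPochhammer j = 0` for `j < k`. [cite: MadrasSlade1993, §1.1 eq. (1.1.8) p. 5; lane plumbing] -/
theorem descPochhammer_coeff_of_lt {j k : ℕ} (h : j < k) : (descPochhammer ℚ j).coeff k = 0 :=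
  Polynomial.coeff_eq_zero_of_natDegree_lt (by rw [descPochhammer_natDegree]; exact h)

/-- ★ READING A COUNT OFF A FALLING-FACTORIAL EXPANSION: if `Σ_{j ≤ M} N_j · D^{(j)} = P(D)` for every `D ∈ ℕ`, `N_j = 0` for
`m < j ≤ M` and `deg P ≤ m ≤ M`, then `N_m = [X^m]P` and `N_{m−1} = [X^{m−1}]P + C(m,2)·N_m` (the falling factorial `X^{(m)}`
contributes its second coefficient `−C(m,2)`). [cite: MadrasSlade1993, §1.1 eq. (1.1.8) p. 5; lane lemma] -/
theorem eq_coeff_of_sum_descFactorial (N : ℕ → ℕ) {m M : ℕ} (hmM : m ≤ M) (hN : ∀ j, m < j → j ≤ M → N j = 0)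
    (P : Polynomial ℚ) (h : ∀ D : ℕ, ((∑ j ∈ Finset.range (M + 1), N j * D.descFactorial j : ℕ) : ℚ) = P.eval (D : ℚ)) :
    (N m : ℚ) = P.coeff m ∧ (1 ≤ m → (N (m - 1) : ℚ) = P.coeff (m - 1) + (m.choose 2 : ℕ) * N m) := by
  classical
  -- the polynomial identity
  set S : Polynomial ℚ := ∑ j ∈ Finset.range (M + 1), Polynomial.C (N j : ℚ) * descPochhammer ℚ j with hS
  have hSP : S = P := by
    refine poly_eq_of_eval_natCast_eq fun D => ?_
    rw [← h D, hS, Polynomial.eval_finsetSum]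
    push_cast
    refine Finset.sum_congr rfl fun j _ => ?_
    rw [Polynomial.eval_C_mul, descPochhammer_eval_eq_descFactorial]
  have hcoeff : ∀ k, P.coeff k = ∑ j ∈ Finset.range (M + 1), (N j : ℚ) * (descPochhammer ℚ j).coeff k := by
    intro k
    rw [← hSP, hS, Polynomial.finsetSum_coeff]
    exact Finset.sum_congr rfl fun j _ => by rw [Polynomial.coeff_C_mul]
  -- the terms `j ≠ k, k+1` vanish at `X^k` when `N` vanishes above `m`
  have hvan : ∀ k, m ≤ k + 1 → ∀ j ∈ Finset.range (M + 1), j ≠ k → j ≠ k + 1 →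
      (N j : ℚ) * (descPochhammer ℚ j).coeff k = 0 := by
    intro k hk j hj hjk hjk1
    rcases lt_or_gt_of_ne hjk with hlt | hgt
    · rw [descPochhammer_coeff_of_lt hlt, mul_zero]
    · rw [hN j (by omega) (by have := Finset.mem_range.1 hj; omega), Nat.cast_zero, zero_mul]
  have hm_mem : m ∈ Finset.range (M + 1) := Finset.mem_range.2 (by omega)
  constructor
  · rw [hcoeff m, ← Finset.add_sum_erase _ _ hm_mem, descPochhammer_coeff_self, mul_one]
    rw [Finset.sum_eq_zero fun j hj => ?_, add_zero]
    have hjm : j ≠ m := Finset.ne_of_mem_erase hj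
    have hj' := Finset.mem_of_mem_erase hj
    by_cases hj1 : j = m + 1
    · rw [hj1, hN (m + 1) (by omega) (by have := Finset.mem_range.1 hj'; omega), Nat.cast_zero, zero_mul]
    · exact hvan m (by omega) j hj' hjm hj1
  · intro hm1
    obtain ⟨m', rfl⟩ : ∃ m', m = m' + 1 := ⟨m - 1, by omega⟩
    rw [show m' + 1 - 1 = m' by omega]
    have hm'_mem : m' ∈ (Finset.range (M + 1)).erase (m' + 1) :=
      Finset.mem_erase.2 ⟨by omega, Finset.mem_range.2 (by omega)⟩
    rw [hcoeff m', ← Finset.add_sum_erase _ _ hm_mem, ← Finset.add_sum_erase _ _ hm'_mem, descPochhammer_coeff_pred,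
      descPochhammer_coeff_self, mul_one, Finset.sum_eq_zero fun j hj => ?_]
    · ring
    · have hj1 : j ≠ m' := Finset.ne_of_mem_erase hj
      have hj2 := Finset.mem_of_mem_erase hj
      have hj3 : j ≠ m' + 1 := Finset.ne_of_mem_erase hj2
      exact hvan m' (by omega) j (Finset.mem_of_mem_erase hj2) hj1 hj3

/-- ★ THE TWO TOP TYPE COUNTS OF A PATTERN: let `Q_D ⊆ Word L D` be a type-invariant family of word sets whose canonical members have at
most `m` axes, and suppose `#Q_D = P(D)` for every `D` with `deg P ≤ m`. Then the canonical words of `Q` with exactly `m` axes number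
`[X^m]P`, and those with `m − 1` axes number `[X^{m−1}]P + C(m,2)·[X^m]P`. [cite: MadrasSlade1993, Definition 1.2.4; §1.1 eq. (1.1.8) p. 5; lane theorem] -/
theorem card_canonical_numAxes_eq_coeff (Q : (D : ℕ) → Word L D → Prop) [∀ D, DecidablePred (Q D)]
    (hQ : ∀ D (u : Word L D), Q D u ↔ Q L (canon u)) {m : ℕ} (hmL : m ≤ L)
    (hvan : ∀ τ : Word L L, canon τ = τ → Q L τ → numAxes τ ≤ m) (P : Polynomial ℚ)
    (hcount : ∀ D : ℕ, ((Finset.univ.filter (Q D)).card : ℚ) = P.eval (D : ℚ)) :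
    (((Finset.univ.filter fun τ : Word L L => canon τ = τ ∧ Q L τ ∧ numAxes τ = m).card : ℚ) = P.coeff m) ∧
    (1 ≤ m → ((Finset.univ.filter fun τ : Word L L => canon τ = τ ∧ Q L τ ∧ numAxes τ = m - 1).card : ℚ) =
      P.coeff (m - 1) + (m.choose 2 : ℕ) * P.coeff m) := by
  classical
  set N : ℕ → ℕ := fun j => ((canonWords L).filter fun τ => Q L τ ∧ numAxes τ = j).card with hN
  have hNj : ∀ j, (Finset.univ.filter fun τ : Word L L => canon τ = τ ∧ Q L τ ∧ numAxes τ = j).card = N j := by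
    intro j
    rw [hN]
    simp only [canonWords, Finset.filter_filter]
  have hvanN : ∀ j, m < j → j ≤ L → N j = 0 := by
    intro j hmj _
    rw [hN, Finset.card_eq_zero, Finset.filter_eq_empty_iff]
    rintro τ hτ ⟨hq, hj⟩
    have := hvan τ (mem_canonWords.1 hτ) hq
    omega
  have hsum : ∀ D : ℕ, ((∑ j ∈ Finset.range (L + 1), N j * D.descFactorial j : ℕ) : ℚ) = P.eval (D : ℚ) := by
    intro D
    rw [← hcount D, card_filter_eq_sum_numAxes (Q D) (Q L) (hQ D)]
  obtain ⟨h1, h2⟩ := eq_coeff_of_sum_descFactorial N hmL hvanN P hsum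
  refine ⟨by rw [hNj, h1], fun hm => ?_⟩
  rw [hNj, h2 hm, h1]

/-! ### Letter patterns: a window whose letters are copies or reverses of a few free letters with distinct axes -/

/-- A letter pattern of length `m`: position `p` carries the letter of its root position `(π p).1`, reversed iff `(π p).2`; a position is
FREE when `π p = (p, false)`. [cite: MadrasSlade1993, §1.2 (p. 10); lane tool notion] -/
abbrev Pat (m : ℕ) : Type := Fin m → Fin m × Bool

/-- The free positions of a pattern. [cite: MadrasSlade1993, §1.2 (p. 10); lane tool notion] -/
def Pat.free (π : Pat m) : Finset (Fin m) := Finset.univ.filter fun p => π p = (p, false)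

/-- A GOOD pattern: roots are free and not later than the position, and adjacent positions have different roots (so that distinct axes
of the free letters make the word reversal-free). [cite: MadrasSlade1993, §1.2 (p. 10); lane tool notion] -/
abbrev Pat.Good (π : Pat m) : Prop :=
  (∀ p : Fin m, π (π p).1 = ((π p).1, false)) ∧ (∀ p : Fin m, (π p).1 ≤ p) ∧
    ∀ p : Fin m, ∀ hp : p.val + 1 < m, (π ⟨p.val + 1, hp⟩).1 ≠ (π p).1

/-- `IsPat π h`: every letter of `h` is the prescribed copy/reverse of the letter at its root, and the free letters have pairwise distinct
axes. [cite: MadrasSlade1993, §1.2 (p. 10); lane tool notion] -/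
abbrev IsPat (π : Pat m) (h : Word m D) : Prop :=
  (∀ p : Fin m, h p = if (π p).2 then ((h (π p).1).1, !(h (π p).1).2) else h (π p).1) ∧
    ∀ p q : Fin m, π p = (p, false) → π q = (q, false) → p ≠ q → (h p).1 ≠ (h q).1

/-- The axis of any letter of a pattern word is the axis of its root. [cite: MadrasSlade1993, §1.2 (p. 10); lane plumbing] -/
theorem IsPat.axis_eq {π : Pat m} {h : Word m D} (hh : IsPat π h) (p : Fin m) : (h p).1 = (h (π p).1).1 := by
  have := hh.1 p
  by_cases hb : (π p).2
  · rw [if_pos hb] at this; rw [this]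
  · rw [if_neg hb] at this; rw [this]

/-- A good pattern with distinct free axes is reversal-free: adjacent letters have different axes. [cite: MadrasSlade1993, §1.2 (p. 10); lane lemma] -/
theorem IsPat.noRev {π : Pat m} (hπ : π.Good) {h : Word m D} (hh : IsPat π h) : NoRev h := by
  intro p hp hrev
  have hax : (h ⟨p.val + 1, hp⟩).1 = (h p).1 := by rw [hrev]
  rw [hh.axis_eq, hh.axis_eq p] at hax
  exact hh.2 _ _ (hπ.1 _) (hπ.1 p) (hπ.2.2 p hp) hax

/-- `IsPat` is a type invariant. [cite: MadrasSlade1993, Definition 1.2.4; lane plumbing] -/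
theorem isPat_iff_of_sameType (π : Pat m) {D' : ℕ} {h : Word m D} {h' : Word m D'} (hs : SameType h h') :
    IsPat π h ↔ IsPat π h' := by
  have key : ∀ {E E' : ℕ} {u : Word m E} {u' : Word m E'}, SameType u u' → IsPat π u → IsPat π u' := by
    intro E E' u u' hs hu
    refine ⟨fun p => ?_, fun p q hp hq hpq hax => hu.2 p q hp hq hpq ((hs.1 p q).2 hax)⟩
    have e := hu.1 p
    by_cases hb : (π p).2
    · rw [if_pos hb] at e ⊢
      rw [Prod.ext_iff] at e ⊢
      exact ⟨(hs.1 _ _).1 e.1, by rw [← hs.2 p, e.2, hs.2]⟩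
    · rw [if_neg hb] at e ⊢
      rw [Prod.ext_iff] at e ⊢
      exact ⟨(hs.1 _ _).1 e.1, by rw [← hs.2 p, e.2, hs.2]⟩
  exact ⟨key hs, key hs.symm⟩

/-- The word of a pattern on given free letters (junk letters at non-free arguments are never read). [cite: MadrasSlade1993, §1.2 (p. 10); lane tool notion] -/
def patWord (π : Pat m) (t : Fin m → Idx D) : Word m D := fun p => if (π p).2 then ((t (π p).1).1, !(t (π p).1).2) else t (π p).1

/-- A pattern word is a pattern word. [cite: MadrasSlade1993, §1.2 (p. 10); lane plumbing] -/
theorem isPat_patWord {π : Pat m} (hπ : π.Good) (t : Fin m → Idx D)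
    (ht : ∀ p q : Fin m, π p = (p, false) → π q = (q, false) → p ≠ q → (t p).1 ≠ (t q).1) : IsPat π (patWord π t) := by
  have hfree : ∀ p : Fin m, π p = (p, false) → patWord π t p = t p := by
    intro p hp; simp [patWord, hp]
  refine ⟨fun p => ?_, fun p q hp hq hpq => by rw [hfree p hp, hfree q hq]; exact ht p q hp hq hpq⟩
  rw [hfree _ (hπ.1 p)]
  rfl

/-- A pattern word is determined by its free letters. [cite: MadrasSlade1993, §1.2 (p. 10); lane plumbing] -/
theorem IsPat.eq_patWord {π : Pat m} {h : Word m D} (hh : IsPat π h) : h = patWord π h := funext fun p => hh.1 p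

/-- ★ COUNTING A PATTERN: the words `h ∈ Word m D` with `IsPat π h` are in bijection with the assignments of letters with pairwise
distinct axes to the `f` free positions, hence number `2^f · D(D−1)⋯(D−f+1)`. [cite: MadrasSlade1993, §1.2 (p. 10); lane lemma] -/
theorem card_isPat {π : Pat m} (hπ : π.Good) (D : ℕ) :
    (Finset.univ.filter fun h : Word m D => IsPat π h).card = 2 ^ π.free.card * D.descFactorial π.free.card := by
  classical
  -- free-letter assignments with distinct axes, as (injection of axes) × (signs)
  set F := π.free with hF
  have hmemF : ∀ p, p ∈ F ↔ π p = (p, false) := fun p => by simp [hF, Pat.free]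
  -- the restriction map to the free positions lands in axis-injective assignments
  let res : Word m D → (F → Idx D) := fun h p => h p.1
  set A : Finset (F → Idx D) := Finset.univ.filter fun t => Function.Injective fun p => (t p).1 with hA
  have hcardA : A.card = 2 ^ F.card * D.descFactorial F.card := by
    -- `A ≃ (F ↪ Fin D) × (F → Bool)`
    let e : {t : F → Idx D // Function.Injective fun p => (t p).1} ≃ (F ↪ Fin D) × (F → Bool) :=
      { toFun := fun t => (⟨fun p => (t.1 p).1, t.2⟩, fun p => (t.1 p).2)
        invFun := fun x => ⟨fun p => (x.1 p, x.2 p), x.1.injective⟩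
        left_inv := fun t => by ext p <;> rfl
        right_inv := fun x => by ext p <;> rfl }
    have h1 : A.card = Fintype.card {t : F → Idx D // Function.Injective fun p => (t p).1} := by
      rw [hA, Fintype.card_subtype]
    rw [h1, Fintype.card_congr e, Fintype.card_prod, Fintype.card_embedding_eq, Fintype.card_fun, Fintype.card_bool,
      Fintype.card_coe, Fintype.card_fin, mul_comm]
  rw [← hcardA]
  -- the free-letter assignment of a pattern word, and the pattern word of an assignment
  have hroot : ∀ p : Fin m, (π p).1 ∈ F := fun p => (hmemF _).2 (hπ.1 p)
  let build : (F → Idx D) → Word m D := fun t p =>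
    if (π p).2 then ((t ⟨(π p).1, hroot p⟩).1, !(t ⟨(π p).1, hroot p⟩).2) else t ⟨(π p).1, hroot p⟩
  have hbuild_free : ∀ (t : F → Idx D) (p : F), build t p.1 = t p := by
    intro t p
    have hp : π p.1 = (p.1, false) := (hmemF _).1 p.2
    have h2 : (π p.1).2 = false := by rw [hp]
    have h1 : (⟨(π p.1).1, hroot p.1⟩ : F) = p := Subtype.ext (by
      change (π p.1).1 = p.1
      rw [hp])
    simp only [build, h2, h1, Bool.false_eq_true, if_false]
  symm
  refine Finset.card_bij' (fun t _ => build t) (fun h _ => res h) ?_ ?_ ?_ ?_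
  · intro t ht
    have hinj : Function.Injective fun p : F => (t p).1 := (Finset.mem_filter.1 ht).2
    refine Finset.mem_filter.2 ⟨Finset.mem_univ _, fun p => ?_, fun p q hp hq hpq hax => ?_⟩
    · have e : build t (π p).1 = t ⟨(π p).1, hroot p⟩ := hbuild_free t ⟨(π p).1, hroot p⟩
      simp only [build, e]
    · rw [show build t p = t ⟨p, (hmemF p).2 hp⟩ from hbuild_free t ⟨p, _⟩,
        show build t q = t ⟨q, (hmemF q).2 hq⟩ from hbuild_free t ⟨q, _⟩] at hax
      exact hpq (congrArg Subtype.val (hinj hax))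
  · intro h hh
    refine Finset.mem_filter.2 ⟨Finset.mem_univ _, fun p q hpq => Subtype.ext ?_⟩
    by_contra hne
    exact (Finset.mem_filter.1 hh).2.2 p.1 q.1 ((hmemF _).1 p.2) ((hmemF _).1 q.2) hne hpq
  · intro t ht
    funext p
    exact hbuild_free t p
  · intro h hh
    have hh' := (Finset.mem_filter.1 hh).2
    funext p
    have e := hh'.1 p
    rw [e]

/-! ### Non-first positions: `numAxes + #(non-first positions) = length` -/

variable {n : ℕ}

/-- A position repeating an earlier axis is not a first occurrence. [cite: MadrasSlade1993, Definition 1.2.4; lane plumbing] -/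
theorem not_isFirst_of_axis_eq (u : Word n D) {q p : Fin n} (hqp : q < p) (h : (u q).1 = (u p).1) : ¬ IsFirst u p :=
  fun hp => hp q hqp h

/-- `numAxes u + #{non-first positions} = n`. [cite: MadrasSlade1993, Definition 1.2.4; lane plumbing] -/
theorem numAxes_add_card_not_isFirst (u : Word n D) :
    numAxes u + (Finset.univ.filter fun p => ¬ IsFirst u p).card = n := by
  classical
  unfold numAxes firsts
  rw [Finset.card_filter_add_card_filter_not (s := Finset.univ) (IsFirst u), Finset.card_univ, Fintype.card_fin]

/-- A set of non-first positions bounds the number of axes: `numAxes u + |S| ≤ n`. [cite: MadrasSlade1993, Definition 1.2.4; lane lemma] -/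
theorem numAxes_add_card_le (u : Word n D) (S : Finset (Fin n)) (hS : ∀ p ∈ S, ¬ IsFirst u p) : numAxes u + S.card ≤ n := by
  classical
  have h := numAxes_add_card_not_isFirst u
  have : S.card ≤ (Finset.univ.filter fun p => ¬ IsFirst u p).card :=
    Finset.card_le_card fun p hp => Finset.mem_filter.2 ⟨Finset.mem_univ _, hS p hp⟩
  omega

/-- In a good pattern a non-free position has an EARLIER root. [cite: MadrasSlade1993, §1.2 (p. 10); lane plumbing] -/
theorem Pat.Good.root_lt {π : Pat m} (hπ : π.Good) {p : Fin m} (hp : π p ≠ (p, false)) : (π p).1 < p := by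
  rcases lt_or_eq_of_le (hπ.2.1 p) with h | h
  · exact h
  · exfalso
    apply hp
    have := hπ.1 p
    rw [h] at this
    exact this

/-- A planted good pattern forces `m − f` non-first positions (the non-free positions of the window), so a canonical word carrying it
has at most `f + (n − m)` axes. [cite: MadrasSlade1993, Definition 1.2.4; lane lemma] -/
theorem numAxes_le_of_atWindow_isPat {π : Pat m} (hπ : π.Good) {k : ℕ} {u : Word n D} (hu : AtWindow (IsPat π) k u) :
    numAxes u + (m - π.free.card) ≤ n := by
  classical
  obtain ⟨hkm, hpat⟩ := hu
  -- the shifted non-free positions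
  set S : Finset (Fin n) := (Finset.univ.filter fun p : Fin m => ¬ π p = (p, false)).map
    ⟨fun p : Fin m => (⟨k + p.val, by omega⟩ : Fin n), fun p q h => Fin.ext (by simpa using congrArg Fin.val h)⟩ with hS
  have hScard : S.card = m - π.free.card := by
    rw [hS, Finset.card_map]
    have := Finset.card_filter_add_card_filter_not (s := (Finset.univ : Finset (Fin m))) (fun p => π p = (p, false))
    rw [Finset.card_univ, Fintype.card_fin] at this
    unfold Pat.free
    omega
  have hle := numAxes_add_card_le u S fun q hq => by
    obtain ⟨p, hp, rfl⟩ := Finset.mem_map.1 hq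
    have hp' : π p ≠ (p, false) := (Finset.mem_filter.1 hp).2
    have hlt := hπ.root_lt hp'
    refine not_isFirst_of_axis_eq u (q := ⟨k + (π p).1.val, by omega⟩) (Fin.mk_lt_mk.2 (by omega)) ?_
    have e := hpat.axis_eq p
    simp only [window_apply] at e
    exact e.symm
  omega

/-! ### The type counts of a planted pattern -/

/-- A window of same-type words has the same type. [cite: MadrasSlade1993, Definition 1.2.4; lane plumbing] -/
theorem SameType.window {D' : ℕ} {u : Word n D} {u' : Word n D'} (hs : SameType u u') (m k : ℕ) (h : k + m ≤ n) :
    SameType (window m k u h) (window m k u' h) :=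
  ⟨fun _ _ => hs.1 _ _, fun _ => hs.2 _⟩

/-- `NoRev` is a type invariant. [cite: MadrasSlade1993, Definition 1.2.4; lane plumbing] -/
theorem SameType.noRev_iff' {D' : ℕ} {u : Word n D} {u' : Word n D'} (hs : SameType u u') : NoRev u ↔ NoRev u' :=
  hs.noRev_iff

/-- `AtWindow (IsPat π) k` is a type invariant. [cite: MadrasSlade1993, Definition 1.2.4; lane plumbing] -/
theorem SameType.atWindow_isPat_iff {D' : ℕ} {u : Word n D} {u' : Word n D'} (hs : SameType u u') (π : Pat m) (k : ℕ) :
    AtWindow (IsPat π) k u ↔ AtWindow (IsPat π) k u' := by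
  unfold AtWindow
  exact exists_congr fun h => isPat_iff_of_sameType π (hs.window m k h)

/-- A good pattern of positive length has a free position (position `0`). [cite: MadrasSlade1993, §1.2 (p. 10); lane plumbing] -/
theorem Pat.Good.free_pos {π : Pat m} (hπ : π.Good) (hm : 0 < m) : 0 < π.free.card := by
  classical
  refine Finset.card_pos.2 ⟨⟨0, hm⟩, ?_⟩
  unfold Pat.free
  refine Finset.mem_filter.2 ⟨Finset.mem_univ _, ?_⟩
  have h0 : (π ⟨0, hm⟩).1 = ⟨0, hm⟩ := Fin.ext (by have := hπ.2.1 ⟨0, hm⟩; exact Nat.le_zero.1 this)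
  have := hπ.1 ⟨0, hm⟩
  rwa [h0] at this

/-- ★ THE WORD-LEVEL COUNT OF A PLANTED PATTERN: `#{w ∈ Word n D : reversal-free, pattern π at offset k} = (2D−1)^{n−m}·2^f·D^{(f)}`.
[cite: MadrasSlade1993, §1.2 (p. 10); lane theorem] -/
theorem card_noRev_atWindow_isPat {π : Pat m} (hπ : π.Good) (hm : 0 < m) {k : ℕ} (hkn : k + m ≤ n) (D : ℕ) :
    (Finset.univ.filter fun w : Word n D => NoRev w ∧ AtWindow (IsPat π) k w).card =
      (2 * D - 1) ^ (n - m) * (2 ^ π.free.card * D.descFactorial π.free.card) := by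
  rw [card_noRev_atWindow hm (IsPat π) hkn, ← card_isPat hπ D]
  congr 1
  exact congrArg Finset.card (Finset.filter_congr fun h _ => ⟨fun hh => hh.2, fun hh => ⟨hh.noRev hπ, hh⟩⟩)

/-- The interpolating polynomial `2^{f+e}·X^{(f)}·(X − ½)^e` of the planted-pattern count and its evaluation
`2^f·D^{(f)}·(2D−1)^e`. [cite: MadrasSlade1993, §1.1 eq. (1.1.8) p. 5; lane plumbing] -/
theorem eval_patPoly (f e D : ℕ) (hf : 0 < f) :
    (Polynomial.C ((2 : ℚ) ^ (f + e)) * (descPochhammer ℚ f * (Polynomial.X - Polynomial.C (1 / 2 : ℚ)) ^ e)).eval (D : ℚ) =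
      (((2 * D - 1) ^ e * (2 ^ f * D.descFactorial f) : ℕ) : ℚ) := by
  rw [Polynomial.eval_mul, Polynomial.eval_C, Polynomial.eval_mul, descPochhammer_eval_eq_descFactorial, Polynomial.eval_pow,
    Polynomial.eval_sub, Polynomial.eval_X, Polynomial.eval_C]
  rcases Nat.eq_zero_or_pos D with rfl | hD
  · obtain ⟨f', rfl⟩ : ∃ f', f = f' + 1 := ⟨f - 1, by omega⟩
    simp
  · have h1 : ((2 * D - 1 : ℕ) : ℚ) = 2 * (D : ℚ) - 1 := by
      rw [Nat.cast_sub (by omega)]; push_cast; ring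
    push_cast [h1]
    have h2 : (2 * (D : ℚ) - 1) = 2 * ((D : ℚ) - 1 / 2) := by ring
    rw [h2, mul_pow, pow_add]
    ring

/-- The top two coefficients of `2^{f+e}·X^{(f)}·(X − ½)^e`: `2^{f+e}` and `−2^{f+e}·(C(f,2) + e/2)`.
[cite: MadrasSlade1993, §1.1 eq. (1.1.8) p. 5; lane plumbing] -/
theorem coeff_patPoly (f e : ℕ) (hf : 0 < f) :
    (Polynomial.C ((2 : ℚ) ^ (f + e)) * (descPochhammer ℚ f * (Polynomial.X - Polynomial.C (1 / 2 : ℚ)) ^ e)).natDegree ≤ f + e ∧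
    (Polynomial.C ((2 : ℚ) ^ (f + e)) * (descPochhammer ℚ f * (Polynomial.X - Polynomial.C (1 / 2 : ℚ)) ^ e)).coeff (f + e) =
      (2 : ℚ) ^ (f + e) ∧
    (Polynomial.C ((2 : ℚ) ^ (f + e)) * (descPochhammer ℚ f * (Polynomial.X - Polynomial.C (1 / 2 : ℚ)) ^ e)).coeff (f + e - 1) =
      -(2 : ℚ) ^ (f + e) * ((f.choose 2 : ℕ) + (e : ℚ) / 2) := by
  set M : Polynomial ℚ := descPochhammer ℚ f * (Polynomial.X - Polynomial.C (1 / 2 : ℚ)) ^ e with hM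
  have hmon1 : (descPochhammer ℚ f).Monic := monic_descPochhammer ℚ f
  have hmon2 : ((Polynomial.X - Polynomial.C (1 / 2 : ℚ)) ^ e).Monic := (Polynomial.monic_X_sub_C _).pow e
  have hmon : M.Monic := hmon1.mul hmon2
  have hdeg2 : ((Polynomial.X - Polynomial.C (1 / 2 : ℚ)) ^ e).natDegree = e := by
    rw [(Polynomial.monic_X_sub_C _).natDegree_pow, Polynomial.natDegree_X_sub_C, mul_one]
  have hdeg : M.natDegree = f + e := by
    rw [hM, hmon1.natDegree_mul hmon2, descPochhammer_natDegree, hdeg2]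
  have hnext : M.nextCoeff = -(((f.choose 2 : ℕ) : ℚ) + (e : ℚ) / 2) := by
    rw [hM, hmon1.nextCoeff_mul hmon2, (Polynomial.monic_X_sub_C _).nextCoeff_pow e,
      Polynomial.nextCoeff_X_sub_C, Polynomial.nextCoeff_of_natDegree_pos (by rw [descPochhammer_natDegree]; exact hf),
      descPochhammer_natDegree]
    obtain ⟨f', rfl⟩ : ∃ f', f = f' + 1 := ⟨f - 1, by omega⟩
    rw [show f' + 1 - 1 = f' by omega, descPochhammer_coeff_pred, nsmul_eq_mul]
    ring
  refine ⟨?_, ?_, ?_⟩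
  · rw [Polynomial.natDegree_C_mul (by positivity), hdeg]
  · rw [Polynomial.coeff_C_mul]
    have : M.coeff (f + e) = 1 := by
      have h := hmon
      rw [Polynomial.Monic, Polynomial.leadingCoeff, hdeg] at h
      exact h
    rw [this, mul_one]
  · rw [Polynomial.coeff_C_mul]
    rcases Nat.eq_zero_or_pos (f + e) with h0 | hpos
    · omega
    · have : M.coeff (f + e - 1) = M.nextCoeff := by
        rw [Polynomial.nextCoeff_of_natDegree_pos (by rw [hdeg]; exact hpos), hdeg]
      rw [this, hnext]
      ring

/-- ★★ THE TYPE COUNTS OF A PLANTED PATTERN: for a good pattern `π` of length `m` with `f` free letters planted at offset `k` in canonical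
reversal-free words of length `n` (`e = n − m`), the words with the MAXIMAL number `f + e` of axes number `2^{f+e}`, and those with
`f + e − 1` axes number `2^{f+e}·(C(f+e,2) − C(f,2) − e/2)`. [cite: MadrasSlade1993, Definition 1.2.4; §1.2 (p. 10); lane theorem] -/
theorem card_canonical_atWindow_isPat {π : Pat m} (hπ : π.Good) (hm : 0 < m) {k : ℕ} (hkn : k + m ≤ n) :
    (Finset.univ.filter fun τ : Word n n => canon τ = τ ∧ (NoRev τ ∧ AtWindow (IsPat π) k τ) ∧
        numAxes τ = π.free.card + (n - m)).card = 2 ^ (π.free.card + (n - m)) ∧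
    (((Finset.univ.filter fun τ : Word n n => canon τ = τ ∧ (NoRev τ ∧ AtWindow (IsPat π) k τ) ∧
        numAxes τ = π.free.card + (n - m) - 1).card : ℚ) =
      (2 : ℚ) ^ (π.free.card + (n - m)) *
        ((((π.free.card + (n - m)).choose 2 : ℕ) : ℚ) - (π.free.card.choose 2 : ℕ) - ((n - m : ℕ) : ℚ) / 2)) := by
  set f := π.free.card with hf
  set e := n - m with he
  have hf0 : 0 < f := hπ.free_pos hm
  obtain ⟨hdegP, hcoeffP, hcoeffP'⟩ := coeff_patPoly f e hf0
  have hfree_le : f ≤ m := by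
    rw [hf]; unfold Pat.free; exact (Finset.card_le_univ _).trans (Fintype.card_fin m).le
  have H := card_canonical_numAxes_eq_coeff (L := n) (fun D (w : Word n D) => NoRev w ∧ AtWindow (IsPat π) k w)
    (fun D u => Iff.and (sameType_canon u).noRev_iff' ((sameType_canon u).atWindow_isPat_iff π k)) (m := f + e) (by omega)
    (fun τ _ hq => by have := numAxes_le_of_atWindow_isPat hπ hq.2; omega) _
    (fun D => by rw [card_noRev_atWindow_isPat hπ hm hkn D, eval_patPoly f e D hf0])
  obtain ⟨H1, H2⟩ := H
  rw [hcoeffP] at H1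
  refine ⟨by exact_mod_cast H1, ?_⟩
  rw [H2 (by omega), hcoeffP', hcoeffP]
  ring

end WordTypes

end Literature.Probability.RandomPlanarGeometry.SAW.Zd

end
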